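import Mathlib.Algebra.Polynomial.Roots
import Mathlib.Algebra.Polynomial.BigOperators
import Summits.Ventures.PackingBounds.ThreePointCert.CheckKSP

/-!
# Multi-point Kronecker validation of sums-of-squares Gram expansions (layout `ks5`)
Framing: lottery ticket; floor = certified bounds/negative ranges. Venture `PackingBounds` (cell
`pub-packcert`), three-point SDP family — kernel-checking infrastructure (lp gen 11).
`ThreePointCert.CheckKSP` compares `R` with `c • Σ_parts Σ_k col_k²` at ONE Kronecker point
`(2^w, 2^{wD}, 2^{wD²})`, manipulating integers of `w·D³` bits once per factor entry; the kernel retains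
the intermediates of a `decide`, so memory grows like entries × `w·D³` bits — the binding constraint
of the `ks4` rows (`pub-packcert-lp/DESIGN-kernel-memory-lp.md`). Here the SAME data
(`CheckKSP.KSPart`) is validated at the `D` points `(2^w, 2^{wD}, τ)`, `τ < D` (Kronecker substitution
in `u, v`, plain evaluation in `t`; integers of `w·D²` bits), one `decide` per point
(`sosCheckKSMAt`, separate kernel caches) plus one for the side conditions (`sosCheckKSMStatic`).
Soundness `boxNonneg_of_sosCheckKSM`: `Δ = c • partsPoly − R` has `t`-degree `< D`; at each point the
balanced-digit lemma (`KroneckerEval.digits_eq_zero`, digits bounded by `absSum Δ · D^D`) kills every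
`(a, b)`-digit `Σ_c Δ_{abc} τ^c`; a polynomial of degree `< D` with `D` roots is zero
(`Polynomial.eq_zero_of_natDegree_lt_card_of_eval_eq_zero`), so `Δ ≡ 0` and `R ≥ 0` on the box.
Kernel programs use `Nat` arithmetic only (`Int` is not kernel-accelerated).
-/


noncomputable section

namespace Summit.Ventures.PackingBounds.ThreePointCert

open Finset
open Literature.Geometry.DiscreteGeometry Literature.Geometry.DiscreteGeometry.PolyCert
open Literature.Geometry.DiscreteGeometry.PolyCert.SPoly

/-! ### The multi-point injectivity theorem -/
/-- The 2-D slot `a + D·b` of a monomial. -/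
def slot2 (D : ℕ) (m : Mono) : ℕ := m.a + D * m.b
/-- The 3-D slot splits as 2-D slot plus `D²·c`. -/
theorem slot_eq_slot2 (D : ℕ) (m : Mono) : slot D m = slot2 D m + D * D * m.c := by
  unfold slot slot2; ring
/-- `slot2 < D²` inside the box. -/
theorem slot2_lt (D : ℕ) (m : Mono) (h : m.a < D ∧ m.b < D ∧ m.c < D) : slot2 D m < D * D := by
  unfold slot2
  have hb : m.b + 1 ≤ D := h.2.1
  calc m.a + D * m.b < D + D * m.b := by omega
    _ = D * (m.b + 1) := by ring
    _ ≤ D * D := Nat.mul_le_mul_left _ hb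
/-- At `(2^w, 2^{wD}, τ)` a monomial is `τ^c · 2^{w·slot2}`. -/
theorem monoEvalZ_kronecker2 (w D : ℕ) (τ : ℤ) (m : Mono) :
    monoEvalZ m (2 ^ w) (2 ^ (w * D)) τ = τ ^ m.c * 2 ^ (w * slot2 D m) := by
  simp only [monoEvalZ, slot2, ← pow_mul]
  rw [show w * (m.a + D * m.b) = w * m.a + w * D * m.b by ring, pow_add]
  ring
/-- **Multi-point Kronecker injectivity.** A term list with exponents `< D`, coefficient mass
`absSum p` with `2 · absSum p · D^D < 2^w`, and integer value `0` at the `D` points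
`(2^w, 2^{wD}, j)`, `j < D`, is the zero function. -/
theorem eval_eq_zero_of_kronecker_points (w D : ℕ) (p : SPoly)
    (hbox : ∀ mc ∈ p, mc.1.a < D ∧ mc.1.b < D ∧ mc.1.c < D)
    (habs : 2 * (absSum p * D ^ D) < 2 ^ w)
    (h0 : ∀ j : ℕ, j < D → evalZ p (2 ^ w) (2 ^ (w * D)) (j : ℤ) = 0)
    (u v t : ℝ) : eval p u v t = 0 := by
  -- indexed data
  let c : Fin p.length → ℤ := fun i => (p[(i : ℕ)]).2
  let s2 : Fin p.length → ℕ := fun i => slot2 D (p[(i : ℕ)]).1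
  let ec : Fin p.length → ℕ := fun i => (p[(i : ℕ)]).1.c
  let s3 : Fin p.length → ℕ := fun i => slot D (p[(i : ℕ)]).1
  have hmem : ∀ i : Fin p.length, p[(i : ℕ)] ∈ p := fun i => List.getElem_mem _
  have habsZ : ((absSum p : ℕ) : ℤ) = ∑ i, |c i| := by
    unfold absSum; rw [sum_map_eq_sum_fin, Nat.cast_sum]
    exact sum_congr rfl fun i _ => Int.natCast_natAbs _
  -- (1) at each point every 2-D digit vanishes
  have h1 : ∀ j : ℕ, j < D → ∀ σ ∈ univ.image s2,
      (∑ i ∈ univ.filter (fun i => s2 i = σ), c i * (j : ℤ) ^ ec i) = 0 := by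
    intro j hj
    have e1 : ∑ i, (c i * (j : ℤ) ^ ec i) * (2 : ℤ) ^ (w * s2 i) = 0 := by
      rw [← h0 j hj]; unfold evalZ; rw [sum_map_eq_sum_fin]
      exact sum_congr rfl fun i _ => by rw [monoEvalZ_kronecker2]; ring
    have e2 : ∑ σ ∈ univ.image s2,
        (∑ i ∈ univ.filter (fun i => s2 i = σ), c i * (j : ℤ) ^ ec i) * (2 : ℤ) ^ (w * σ) = 0 := by
      rw [← sum_mul_apply_eq_sum_fiber s2 (fun i => c i * (j : ℤ) ^ ec i) (fun σ => (2 : ℤ) ^ (w * σ))]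
      exact e1
    have hC : ∀ σ, |∑ i ∈ univ.filter (fun i => s2 i = σ), c i * (j : ℤ) ^ ec i| ≤
        ((absSum p * D ^ D : ℕ) : ℤ) := by
      intro σ
      have hterm : ∀ i, |c i * (j : ℤ) ^ ec i| ≤ |c i| * (D : ℤ) ^ D := by
        intro i
        rw [abs_mul, abs_pow, Nat.abs_cast]
        refine mul_le_mul_of_nonneg_left ?_ (abs_nonneg _)
        have hcD : ec i < D := (hbox _ (hmem i)).2.2
        have hD1 : (1 : ℤ) ≤ D := by exact_mod_cast (show 1 ≤ D by omega)
        calc ((j : ℤ)) ^ ec i ≤ (D : ℤ) ^ ec i :=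
              pow_le_pow_left₀ (by positivity) (by exact_mod_cast hj.le) _
          _ ≤ (D : ℤ) ^ D := pow_le_pow_right₀ hD1 hcD.le
      calc |∑ i ∈ univ.filter (fun i => s2 i = σ), c i * (j : ℤ) ^ ec i|
          ≤ ∑ i ∈ univ.filter (fun i => s2 i = σ), |c i * (j : ℤ) ^ ec i| := abs_sum_le_sum_abs _ _
        _ ≤ ∑ i, |c i * (j : ℤ) ^ ec i| :=
            sum_le_sum_of_subset_of_nonneg (filter_subset _ _) fun i _ _ => abs_nonneg _
        _ ≤ ∑ i, |c i| * (D : ℤ) ^ D := sum_le_sum fun i _ => hterm i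
        _ = ((absSum p * D ^ D : ℕ) : ℤ) := by rw [Nat.cast_mul, habsZ, sum_mul]; push_cast; rfl
    exact digits_eq_zero w (absSum p * D ^ D) habs _ hC _ e2
  -- (2) per 2-D slot: the t-polynomial of degree < D vanishes at D points, so its coefficients do
  have h2 : ∀ σ ∈ univ.image s2, ∀ e : ℕ,
      (∑ i ∈ univ.filter (fun i => s2 i = σ ∧ ec i = e), c i) = 0 := by
    intro σ hσ e
    have hD : 0 < D := by
      obtain ⟨i, _, _⟩ := mem_image.1 hσ
      have := (hbox _ (hmem i)).2.2; omega
    let P : Polynomial ℤ := ∑ i ∈ univ.filter (fun i => s2 i = σ), Polynomial.C (c i) * Polynomial.X ^ ec i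
    have hP0 : P = 0 := by
      refine Polynomial.eq_zero_of_natDegree_lt_card_of_eval_eq_zero P
        (f := fun j : Fin D => ((j : ℕ) : ℤ)) ?_ ?_ ?_
      · intro a b h
        simp only at h
        exact Fin.ext (by exact_mod_cast h)
      · intro j
        simp only [P, Polynomial.eval_finsetSum, Polynomial.eval_mul, Polynomial.eval_C,
          Polynomial.eval_pow, Polynomial.eval_X]
        exact h1 j j.isLt σ hσ
      · rw [Fintype.card_fin]
        have hle : P.natDegree ≤ D - 1 :=
          Polynomial.natDegree_sum_le_of_forall_le _ _ fun i _ =>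
            (Polynomial.natDegree_C_mul_X_pow_le (c i) (ec i)).trans
              (by have := (hbox _ (hmem i)).2.2; show (p[(i : ℕ)]).1.c ≤ D - 1; omega)
        omega
    have hcoef := congrArg (fun Q : Polynomial ℤ => Q.coeff e) hP0
    simp only [P, Polynomial.finsetSum_coeff, Polynomial.coeff_C_mul_X_pow,
      Polynomial.coeff_zero] at hcoef
    rw [← hcoef, sum_filter, sum_filter]
    refine sum_congr rfl fun i _ => ?_
    by_cases h1' : s2 i = σ
    · by_cases h2' : ec i = e
      · simp [h1', h2']
      · simp [h1', h2', Ne.symm h2']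
    · simp [h1']
  -- (3) every 3-D coefficient fibre vanishes
  have h3 : ∀ j ∈ univ.image s3, (∑ i ∈ univ.filter (fun i => s3 i = j), c i) = 0 := by
    intro j hj
    obtain ⟨i0, _, rfl⟩ := mem_image.1 hj
    have hs2lt : ∀ i, s2 i < D * D := fun i => slot2_lt D _ (hbox _ (hmem i))
    have key : ∀ i, s3 i = s3 i0 ↔ (s2 i = s2 i0 ∧ ec i = ec i0) := by
      intro i
      have e1 : s3 i = s2 i + D * D * ec i := slot_eq_slot2 D _
      have e0 : s3 i0 = s2 i0 + D * D * ec i0 := slot_eq_slot2 D _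
      constructor
      · intro h
        rw [e1, e0] at h
        have hDD : 0 < D * D := by
          have := hs2lt i; omega
        have hm := congrArg (· % (D * D)) h
        have hq := congrArg (· / (D * D)) h
        simp only [Nat.add_mul_mod_self_left, Nat.mod_eq_of_lt (hs2lt i),
          Nat.mod_eq_of_lt (hs2lt i0)] at hm
        simp only [Nat.add_mul_div_left _ _ hDD, Nat.div_eq_of_lt (hs2lt i),
          Nat.div_eq_of_lt (hs2lt i0), zero_add] at hq
        exact ⟨hm, hq⟩
      · rintro ⟨ha, hb⟩
        rw [e1, e0, ha, hb]
    rw [show univ.filter (fun i => s3 i = s3 i0) =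
        univ.filter (fun i => s2 i = s2 i0 ∧ ec i = ec i0) from filter_congr fun i _ => key i]
    exact h2 (s2 i0) (mem_image_of_mem _ (mem_univ _)) (ec i0)
  -- (4) the real value regrouped along 3-D slots
  have h4 : eval p u v t = ∑ i, (c i : ℝ) * (ofSlot D (s3 i)).eval u v t := by
    unfold eval; rw [sum_map_eq_sum_fin]
    exact sum_congr rfl fun i _ => by rw [ofSlot_slot D _ (hbox _ (hmem i))]
  rw [h4, sum_mul_apply_eq_sum_fiber s3 (fun i => (c i : ℝ)) (fun j => (ofSlot D j).eval u v t)]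
  refine sum_eq_zero fun j hj => ?_
  have : ((∑ i ∈ univ.filter (fun i => s3 i = j), c i : ℤ) : ℝ) =
      ∑ i ∈ univ.filter (fun i => s3 i = j), (c i : ℝ) := Int.cast_sum _ _
  rw [← this, h3 j hj]; simp

/-! ### Kernel programs (`Nat` arithmetic only) -/
/-- Bit position `w·(a + D·b)` of the 2-D slot of a monomial. -/
def pos2 (w D : ℕ) (m : Mono) : ℕ := Nat.mul w (Nat.add m.a (Nat.mul D m.b))
/-- Positive part `Σ_{c > 0} c · τ^{m.c} · 2^{pos2}` of a term list at `(2^w, 2^{wD}, τ)`. -/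
def encPA (w D τ : ℕ) (p : SPoly) : ℕ :=
  p.rec (motive := fun _ => ℕ) 0 (fun mc _ acc =>
    Int.rec (motive := fun _ => ℕ)
      (fun n => Nat.add acc (Nat.shiftLeft (Nat.mul n (Nat.pow τ mc.1.c)) (pos2 w D mc.1)))
      (fun _ => acc) mc.2)
/-- Negative part `Σ_{c < 0} |c| · τ^{m.c} · 2^{pos2}` of a term list at `(2^w, 2^{wD}, τ)`. -/
def encNA (w D τ : ℕ) (p : SPoly) : ℕ :=
  p.rec (motive := fun _ => ℕ) 0 (fun mc _ acc =>
    Int.rec (motive := fun _ => ℕ) (fun _ => acc)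
      (fun n => Nat.add acc (Nat.shiftLeft (Nat.mul (Nat.succ n) (Nat.pow τ mc.1.c)) (pos2 w D mc.1)))
      mc.2)
/-- Evaluate `e` to a numeral before continuing (so a basis value is computed once, not per use). -/
def forceNat {α : Type} (e : ℕ) (k : ℕ → α) : α :=
  Nat.rec (motive := fun _ => α) (k 0) (fun n _ => k (Nat.succ n)) e
/-- Positive/negative parts of every basis polynomial at the point, forced. -/
def encBasisA (w D τ : ℕ) (vs : List SPoly) : List (ℕ × ℕ) :=
  vs.rec (motive := fun _ => List (ℕ × ℕ)) []
    (fun v _ ih => forceNat (encPA w D τ v) fun P => forceNat (encNA w D τ v) fun N => (P, N) :: ih)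
/-- `(P − N)²` on naturals. -/
def sqDiff (P N : ℕ) : ℕ :=
  Bool.rec (motive := fun _ => ℕ) (Nat.mul (Nat.sub N P) (Nat.sub N P)) (Nat.mul (Nat.sub P N) (Nat.sub P N))
    (Nat.ble N P)
/-- One column: accumulate `Σ e·qP`, `Σ e·qN`, `Σ qP`, `Σ qN` over the zipped prefix of entries and
basis values, then return `(P − N)²` with `P = Σ e·qP + B·Σ qN`, `N = Σ e·qN + B·Σ qP`
(so `P − N = Σ_j (e_j − B)(qP_j − qN_j)`). -/
def colAccA (B : ℕ) (es : List ℕ) : List (ℕ × ℕ) → ℕ → ℕ → ℕ → ℕ → ℕ :=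
  es.rec (motive := fun _ => List (ℕ × ℕ) → ℕ → ℕ → ℕ → ℕ → ℕ)
    (fun _ aP aN sP sN => sqDiff (Nat.add aP (Nat.mul B sN)) (Nat.add aN (Nat.mul B sP)))
    (fun e _ ih qs aP aN sP sN => qs.casesOn (motive := fun _ => ℕ)
      (sqDiff (Nat.add aP (Nat.mul B sN)) (Nat.add aN (Nat.mul B sP)))
      (fun q qs' => q.casesOn (motive := fun _ => ℕ) fun qP qN =>
        ih qs' (Nat.add aP (Nat.mul e qP)) (Nat.add aN (Nat.mul e qN)) (Nat.add sP qP) (Nat.add sN qN)))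
/-- `Σ_k col_k²` at the point, column `k` against the basis-value suffix from `k`. -/
def sosSqA (B : ℕ) (cols : List (List ℕ)) : List (ℕ × ℕ) → ℕ :=
  cols.rec (motive := fun _ => List (ℕ × ℕ) → ℕ) (fun _ => 0)
    (fun es _ ih qs => Nat.add (colAccA B es qs 0 0 0 0) (ih qs.tail))
/-- Value `Σ_k col_k²` of one part at the point `(2^w, 2^{wD}, τ)`. -/
def KSPart.valA (w D τ : ℕ) (P : KSPart) : ℕ := sosSqA P.B P.cols (encBasisA w D τ P.vs)

/-- Sum of the part values at the point. -/
def partsValA (w D τ : ℕ) (Ps : List KSPart) : ℕ :=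
  Ps.rec (motive := fun _ => ℕ) 0 (fun P _ ih => Nat.add (KSPart.valA w D τ P) ih)

/-- **Static side conditions** (checked once): part side conditions, exponent box of `R`, and the
width bound `2 · (absSum R + c · Σ bounds) · D^D < 2^w` for the `D` evaluation points `τ < D`. -/
def sosCheckKSMStatic (w D c : ℕ) (Ps : List KSPart) (R : SPoly) : Bool :=
  Ps.all (KSPart.ok D) && boxOK D R && decide (2 * ((absSum R + c * partsBound Ps) * D ^ D) < 2 ^ w)

/-- **The value check at one point** `(2^w, 2^{wD}, τ)`: `R = c · Σ_parts Σ_k col_k²` there. -/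
def sosCheckKSMAt (w D c τ : ℕ) (Ps : List KSPart) (R : SPoly) : Bool :=
  Nat.beq (encPA w D τ R) (Nat.add (encNA w D τ R) (Nat.mul c (partsValA w D τ Ps)))

/-! ### Meaning of the programs -/

/-- `pos2 = w · slot2`. -/
theorem pos2_eq (w D : ℕ) (m : Mono) : pos2 w D m = w * slot2 D m := rfl

/-- The two parts give the value at the point. -/
theorem encA_eq (w D τ : ℕ) : ∀ p : SPoly,
    ((encPA w D τ p : ℕ) : ℤ) - (encNA w D τ p : ℕ) = evalZ p (2 ^ w) (2 ^ (w * D)) (τ : ℤ)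
  | [] => by simp [encPA, encNA]
  | (m, c) :: p => by
    have ih := encA_eq w D τ p
    rw [evalZ_cons, ← ih, monoEvalZ_kronecker2, ← pos2_eq]
    cases c with
    | ofNat n =>
      show ((Nat.add (encPA w D τ p) (Nat.shiftLeft (Nat.mul n (Nat.pow τ m.c)) (pos2 w D m)) : ℕ) : ℤ) -
          (encNA w D τ p : ℕ) = _
      show ((encPA w D τ p + (n * τ ^ m.c) <<< pos2 w D m : ℕ) : ℤ) - (encNA w D τ p : ℕ) = _
      rw [Nat.shiftLeft_eq]; simp only [Int.ofNat_eq_natCast]; push_cast; ring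
    | negSucc n =>
      show ((encPA w D τ p : ℕ) : ℤ) -
          (Nat.add (encNA w D τ p) (Nat.shiftLeft (Nat.mul (Nat.succ n) (Nat.pow τ m.c)) (pos2 w D m)) : ℕ) = _
      show ((encPA w D τ p : ℕ) : ℤ) - (encNA w D τ p + ((n + 1) * τ ^ m.c) <<< pos2 w D m : ℕ) = _
      rw [Nat.shiftLeft_eq, Int.negSucc_eq]; push_cast; ring

/-- `forceNat` is application. -/
theorem forceNat_eq {α : Type} (e : ℕ) (k : ℕ → α) : forceNat e k = k e := by
  cases e <;> rfl

/-- The forced basis list is the plain map. -/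
theorem encBasisA_eq (w D τ : ℕ) : ∀ vs : List SPoly,
    encBasisA w D τ vs = vs.map fun v => (encPA w D τ v, encNA w D τ v)
  | [] => rfl
  | v :: vs => by
    show forceNat (encPA w D τ v) (fun P => forceNat (encNA w D τ v) fun N => (P, N) :: encBasisA w D τ vs) = _
    rw [forceNat_eq, forceNat_eq, encBasisA_eq w D τ vs, List.map_cons]

/-- `sqDiff P N = (P − N)²`. -/
theorem sqDiff_eq (P N : ℕ) : ((sqDiff P N : ℕ) : ℤ) = ((P : ℤ) - N) ^ 2 := by
  unfold sqDiff
  cases h : Nat.ble N P with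
  | true =>
    have hle : N ≤ P := Nat.le_of_ble_eq_true h
    show ((Nat.mul (Nat.sub P N) (Nat.sub P N) : ℕ) : ℤ) = _
    show (((P - N) * (P - N) : ℕ) : ℤ) = _
    push_cast [hle]; ring
  | false =>
    have hlt : P < N := Nat.lt_of_not_le fun h' => by simp [Nat.ble_eq_true_of_le h'] at h
    show ((Nat.mul (Nat.sub N P) (Nat.sub N P) : ℕ) : ℤ) = _
    show (((N - P) * (N - P) : ℕ) : ℤ) = _
    push_cast [hlt.le]; ring

/-- The semantic column sum `Σ_j (e_j − B)·(qP_j − qN_j)` over the zipped prefix. -/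
def colSemA (B : ℕ) : List ℕ → List (ℕ × ℕ) → ℤ
  | e :: es, q :: qs => ((e : ℤ) - B) * ((q.1 : ℤ) - q.2) + colSemA B es qs
  | _, _ => 0

/-- Accumulator law of `colAccA`. -/
theorem colAccA_eq (B : ℕ) : ∀ (es : List ℕ) (qs : List (ℕ × ℕ)) (aP aN sP sN : ℕ),
    ((colAccA B es qs aP aN sP sN : ℕ) : ℤ) =
      (((aP : ℤ) - aN) + (B : ℤ) * ((sN : ℤ) - sP) + colSemA B es qs) ^ 2
  | [], qs, aP, aN, sP, sN => by
    cases qs <;>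
    · show ((sqDiff (Nat.add aP (Nat.mul B sN)) (Nat.add aN (Nat.mul B sP)) : ℕ) : ℤ) = _
      rw [sqDiff_eq]; simp only [colSemA]
      show (((aP + B * sN : ℕ) : ℤ) - ((aN + B * sP : ℕ) : ℤ)) ^ 2 = _
      push_cast; ring
  | e :: es, [], aP, aN, sP, sN => by
    show ((sqDiff (Nat.add aP (Nat.mul B sN)) (Nat.add aN (Nat.mul B sP)) : ℕ) : ℤ) = _
    rw [sqDiff_eq]; simp only [colSemA]
    show (((aP + B * sN : ℕ) : ℤ) - ((aN + B * sP : ℕ) : ℤ)) ^ 2 = _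
    push_cast; ring
  | e :: es, (qP, qN) :: qs, aP, aN, sP, sN => by
    show ((colAccA B es qs (Nat.add aP (Nat.mul e qP)) (Nat.add aN (Nat.mul e qN)) (Nat.add sP qP)
      (Nat.add sN qN) : ℕ) : ℤ) = _
    rw [colAccA_eq B es qs]
    simp only [colSemA]
    show ((((aP + e * qP : ℕ) : ℤ) - ((aN + e * qN : ℕ) : ℤ)) + (B : ℤ) * (((sN + qN : ℕ) : ℤ) - ((sP + qP : ℕ) : ℤ)) +
      colSemA B es qs) ^ 2 = _
    push_cast; ring

/-- The column polynomial at any integer point is the semantic column sum over the basis values. -/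
theorem evalZ_colPolyP_pt (B : ℕ) (x y z : ℤ) (f : SPoly → ℕ × ℕ)
    (hf : ∀ v, ((f v).1 : ℤ) - (f v).2 = evalZ v x y z) : ∀ (es : List ℕ) (vs : List SPoly),
    evalZ (colPolyP B es vs) x y z = colSemA B es (vs.map f)
  | [], vs => by cases vs <;> simp [colPolyP, colSemA]
  | e :: es, [] => by simp [colPolyP, colSemA]
  | e :: es, v :: vs => by
    rw [colPolyP, evalZ_append, evalZ_smul, evalZ_colPolyP_pt B x y z f hf es vs, List.map_cons, colSemA,
      ← hf v]

/-- The part value program computes `Σ_k col_k²` at the point. -/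
theorem sosSqA_eq (w D τ B : ℕ) : ∀ (cols : List (List ℕ)) (vs : List SPoly),
    ((sosSqA B cols (encBasisA w D τ vs) : ℕ) : ℤ) =
      evalZ (sosPolyP B cols vs) (2 ^ w) (2 ^ (w * D)) (τ : ℤ)
  | [], vs => by simp [sosSqA, sosPolyP]
  | es :: cols, vs => by
    have ih := sosSqA_eq w D τ B cols vs.tail
    have htail : (encBasisA w D τ vs).tail = encBasisA w D τ vs.tail := by
      rw [encBasisA_eq, encBasisA_eq]; cases vs <;> rfl
    show ((Nat.add (colAccA B es (encBasisA w D τ vs) 0 0 0 0) (sosSqA B cols (encBasisA w D τ vs).tail) : ℕ) : ℤ) = _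
    rw [htail, sosPolyP, evalZ_append, evalZ_mul]
    show (((colAccA B es (encBasisA w D τ vs) 0 0 0 0 + sosSqA B cols (encBasisA w D τ vs.tail) : ℕ) : ℤ)) = _
    push_cast
    rw [ih, colAccA_eq, encBasisA_eq,
      ← evalZ_colPolyP_pt B (2 ^ w) (2 ^ (w * D)) (τ : ℤ) (fun v => (encPA w D τ v, encNA w D τ v))
        (fun v => encA_eq w D τ v) es vs]
    ring

/-- The parts value program computes `partsPoly` at the point. -/
theorem partsValA_eq (w D τ : ℕ) : ∀ Ps : List KSPart,
    ((partsValA w D τ Ps : ℕ) : ℤ) = evalZ (partsPoly Ps) (2 ^ w) (2 ^ (w * D)) (τ : ℤ)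
  | [] => by simp [partsValA, partsPoly]
  | P :: Ps => by
    show ((Nat.add (KSPart.valA w D τ P) (partsValA w D τ Ps) : ℕ) : ℤ) = _
    show (((KSPart.valA w D τ P + partsValA w D τ Ps : ℕ) : ℤ)) = _
    rw [partsPoly, evalZ_append, Nat.cast_add, partsValA_eq w D τ Ps, KSPart.valA, sosSqA_eq]

/-! ### Soundness -/

/-- **Soundness of the multi-point check**: the static side conditions together with the value
equation at every point `τ < D` give `R = c • Σ_parts Σ_k col_k²` as a function. -/
theorem eval_eq_parts_of_sosCheckKSM (w D c : ℕ) (Ps : List KSPart) (R : SPoly)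
    (hs : sosCheckKSMStatic w D c Ps R = true) (hv : ∀ j : ℕ, j < D → sosCheckKSMAt w D c j Ps R = true)
    (u v t : ℝ) : eval R u v t = (c : ℝ) * eval (partsPoly Ps) u v t := by
  unfold sosCheckKSMStatic at hs
  simp only [Bool.and_eq_true, decide_eq_true_eq] at hs
  obtain ⟨⟨hPs, hR⟩, hw⟩ := hs
  obtain ⟨-, e2, e3⟩ := partsPoly_spec w D Ps hPs
  have hQ := eval_eq_zero_of_kronecker_points w D (smul (c : ℤ) (partsPoly Ps) ++ neg R)
    (fun mc hmc => by
      rcases List.mem_append.1 hmc with h | h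
      · simp only [smul, List.mem_map] at h
        obtain ⟨a, ha, rfl⟩ := h
        exact e3 a ha
      · exact inBox_neg D R hR mc h)
    (by
      rw [absSum_append, absSum_neg, absSum_smul, Int.natAbs_natCast]
      have h1 : (c * absSum (partsPoly Ps) + absSum R) * D ^ D ≤ (absSum R + c * partsBound Ps) * D ^ D :=
        Nat.mul_le_mul_right _ (by have := Nat.mul_le_mul_left c e2; omega)
      omega)
    (fun j hj => by
      have h := hv j hj
      unfold sosCheckKSMAt at h
      have h' := Nat.eq_of_beq_eq_true h
      have hz : ((encPA w D j R : ℕ) : ℤ) = (encNA w D j R : ℕ) + (c : ℤ) * (partsValA w D j Ps : ℕ) := by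
        have := congrArg (fun n : ℕ => (n : ℤ)) h'
        simpa using this
      rw [evalZ_append, evalZ_neg, evalZ_smul, ← partsValA_eq, ← encA_eq, hz]; ring)
    u v t
  rw [eval_append, eval_neg, eval_smul, Int.cast_natCast] at hQ
  linarith

/-- **Box-nonnegativity from the multi-point check** (same consumer as `boxNonneg_of_sosCheckKSParts`:
`SoundNN.PolysNN3`, with `boxNonneg_append` / `boxNonneg_smul`). -/
theorem boxNonneg_of_sosCheckKSM (w D c : ℕ) (Ps : List KSPart) (R : SPoly)
    (hs : sosCheckKSMStatic w D c Ps R = true) (hv : ∀ j : ℕ, j < D → sosCheckKSMAt w D c j Ps R = true) :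
    BoxNonneg R :=
  fun u v t _ _ _ => by
    rw [eval_eq_parts_of_sosCheckKSM w D c Ps R hs hv]
    exact mul_nonneg (by exact_mod_cast Nat.zero_le c) (eval_partsPoly_nonneg u v t Ps)

/-! ### Assembling the per-point facts (each point is its own kernel-checked theorem) -/

/-- No obligations below `0`. -/
theorem forall_lt_zero {P : ℕ → Prop} : ∀ j : ℕ, j < 0 → P j := fun _ h => absurd h (Nat.not_lt_zero _)

/-- Extend `∀ j < n` by the fact at `n`. A row file proves `sosCheckKSMAt … j … = true` for
`j = 0, …, D − 1` as separate theorems and chains them with this lemma. -/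
theorem forall_lt_succ {P : ℕ → Prop} {n : ℕ} (h : ∀ j : ℕ, j < n → P j) (hn : P n) :
    ∀ j : ℕ, j < n + 1 → P j := fun j hj =>
  (Nat.lt_succ_iff_lt_or_eq.1 hj).elim (h j) fun e => e ▸ hn

end Summit.Ventures.PackingBounds.ThreePointCert

end
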